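import Mathlib.FieldTheory.RatFunc.AsPolynomial
import Mathlib.FieldTheory.Differential.Liouville
import Literature.NumberTheory.Transcendental.RosenlichtProp4Residues
import Literature.NumberTheory.Transcendental.AxSchanuelWeierstrassDescent
import Literature.NumberTheory.Transcendental.AxSchanuelWeierstrassLaurent
import HarnessLib

/-!
# The elliptic analogue of Rosenlicht 1976, Prop. 4: `Σ cᵢ dXᵢ/Yᵢ = dv` forces `v` algebraic

Topic `Literature/NumberTheory/Transcendental`. Fourth support file for discharging the named
fact `Literature.NumberTheory.Transcendental.ax_schanuel_weierstrass` (`AxSchanuelWeierstrass.lean`;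
J. Kirby, Selecta Math. 15 (2009), Thm. 3.8 for `S = Eⁿ`). Everything here is PROVED.

**Statement** (`isAlgebraic_of_sum_invDiff`, dual form). Let `k ⊆ K` be fields of
characteristic zero, `E : Y² = 4X³ - g₂X - g₃` with `g₂, g₃ ∈ k`, `g₂³ - 27g₃² ≠ 0`,
`(Xᵢ, Yᵢ) ∈ E(K)` affine points with `Yᵢ ≠ 0`, `cᵢ ∈ k` and `v ∈ K`. If
`Σᵢ cᵢ · δXᵢ/Yᵢ = δv` for every `k`-derivation `δ` of `K` (i.e. `Σ cᵢ ζ(Pᵢ) = dv` in `Ω[K⁄k]`,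
`ζ = dX/Y` the invariant differential), then `v` is algebraic over `k`.

This replaces, for `Eⁿ`, Steps 2–4 of Kirby's proof of his Prop. 3.7 (Chevalley's theorem on
algebraic subgroups generated by subvarieties): in the proof of `ax_schanuel_weierstrass`
(`AxSchanuelWeierstrassProofs.lean`) it is applied to the constant-coefficient relation produced
by the Wronskian lemma, exactly as Rosenlicht's Prop. 4 is applied in the multiplicative case
(`AxSchanuelProofs.lean`).

**Proof** (the architecture of `Rosenlicht.isAlgebraic_of_forall_derivation`, with the
logarithmic derivative replaced by `λ(P) = X′/Y`). Suppose `v` is transcendental; so is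
`s = v⁻¹`. Complete `s` to a transcendence basis: `k₁`, `L = k₁(s) ≅ k₁(t)`, `K/L` algebraic
(`exists_derivation_of_transcendental`). Give `L` the Euler derivation `θ = t·d/dt` (`θs = s`,
so `θv = -v`), extend it to the finite extension `K' = L(Xᵢ, Yᵢ)` (Mathlib's `Differential`
structure) and on to `K`; the hypothesis for this derivation reads `Σ cᵢ λ(Pᵢ) = -s⁻¹` in `K'`,
with `Pᵢ = (Xᵢ, Yᵢ/2)` on `y² = x³ - (g₂/4)x - g₃/4`. Galois averaging
(`exists_nat_mul_eq_sum_invDiff`, Kirby's Lemma 3.1) descends it to `-N s⁻¹ = Σ cᵢ μᵢ` in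
`L ≅ k₁(t)` with each `μᵢ` zero or `θU/(2V)` for a `k₁(t)`-point `(U, V)`, `V ≠ 0`. Expanding in
`k₁⸨t⸩`, every `μᵢ` has no term in `t⁻¹` (`coeff_eulerDerivation_div_eq_zero`: the invariant
differential has no poles), whereas `-N s⁻¹ = -N t⁻¹` does: contradiction.

## References

* J. Kirby, Selecta Math. (N.S.) 15 (2009), 445–486, Lemma 3.1, Prop. 3.7, Thm. 3.8.
* M. Rosenlicht, Pacific J. Math. 65 (1976), 485–492, Prop. 4 (the argument transposed here).
-/

noncomputable section

namespace Literature.NumberTheory.Transcendental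

namespace AxSchanuelWeierstrass

open scoped _root_.Differential _root_.IntermediateField LaurentSeries
open _root_.Polynomial _root_.RatFunc _root_.WeierstrassCurve _root_.WeierstrassCurve.Affine

/-! ### The curve `y² = x³ - (g₂/4)x - g₃/4` -/

/-- The discriminant of `y² = x³ + Ax + B` in Mathlib's normalisation is `-16(4A³ + 27B²)`.
[folklore] -/
theorem Δ_short {R : Type*} [CommRing R] (A B : R) :
    (WeierstrassCurve.mk 0 0 0 A B).Δ = -16 * (4 * A ^ 3 + 27 * B ^ 2) := by
  simp only [WeierstrassCurve.Δ, WeierstrassCurve.b₂, WeierstrassCurve.b₄, WeierstrassCurve.b₆,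
    WeierstrassCurve.b₈]
  ring

/-- For `A = -g₂/4`, `B = -g₃/4`: `4A³ + 27B² = -(g₂³ - 27g₃²)/16`. [folklore] -/
theorem four_mul_cube_add {F : Type*} [Field F] [CharZero F] (g₂ g₃ : F) :
    4 * (-g₂ / 4) ^ 3 + 27 * (-g₃ / 4) ^ 2 = -(g₂ ^ 3 - 27 * g₃ ^ 2) / 16 := by
  field_simp
  ring

/-- The coefficient of `t⁻¹` of `-N t⁻¹` is `-N`. [folklore] -/
theorem coeff_neg_one_natCast_mul_inv_X {F : Type*} [Field F] (N : ℕ) :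
    ((((N : RatFunc F) * RatFunc.X⁻¹ : RatFunc F) : F⸨X⸩)).coeff (-1) = N := by
  rw [map_mul, map_natCast, map_inv₀, RatFunc.coe_X, HahnSeries.inv_single, inv_one,
    show ((N : F⸨X⸩)) = HahnSeries.C (N : F) from (map_natCast HahnSeries.C N).symm,
    HahnSeries.C_mul_eq_smul, HahnSeries.coeff_smul, HahnSeries.coeff_single_same, smul_eq_mul,
    mul_one]

/-- The local input, transported to `k₁(t)`: for a `k₁(t)`-point `(U, V)`, `V ≠ 0`, of
`y² = x³ + Ax + B` (`4A³ + 27B² ≠ 0`) and `θ = t·d/dt`, the expansion of `θU/(2V)` has no term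
in `t⁻¹`. [folklore] -/
theorem coeff_neg_one_invDiff_ratFunc {F : Type*} [Field F] [CharZero F]
    (θ : Derivation F (RatFunc F) (RatFunc F)) (hθ : θ RatFunc.X = RatFunc.X) {A B : F}
    (hAB : 4 * A ^ 3 + 27 * B ^ 2 ≠ 0) {U V : RatFunc F} (hV : V ≠ 0)
    (hE : V ^ 2 = U ^ 3 + RatFunc.C A * U + RatFunc.C B) :
    (((θ U / (2 * V) : RatFunc F)) : F⸨X⸩).coeff (-1) = 0 := by
  have hV' : ((V : RatFunc F) : F⸨X⸩) ≠ 0 :=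
    (_root_.map_ne_zero (algebraMap (RatFunc F) F⸨X⸩)).mpr hV
  have hE' : ((V : RatFunc F) : F⸨X⸩) ^ 2 =
      ((U : RatFunc F) : F⸨X⸩) ^ 3 + HahnSeries.C A * ((U : RatFunc F) : F⸨X⸩) +
        HahnSeries.C B := by
    have := congrArg (algebraMap (RatFunc F) F⸨X⸩) hE
    simpa only [map_pow, map_add, map_mul, LaurentEuler.coe_ratFunc_C] using this
  rw [map_div₀, map_mul, map_ofNat, LaurentEuler.coe_derivation_eq_eulerDerivation θ hθ]
  exact coeff_eulerDerivation_div_eq_zero hAB hV' hE' (by norm_num)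

/-! ### The elliptic Prop. 4 -/

-- one self-contained argument through the fields `k ⊆ k₁ ⊆ L = k₁(s) ⊆ K' ⊆ K` and `k₁(X) ≅ L`;
-- the coercion bookkeeping between them exceeds the default budget by a small factor
set_option maxHeartbeats 800000 in
/-- **The elliptic analogue of Rosenlicht 1976, Prop. 4 (⇒), dual form.** Let `k ⊆ K` be fields
of characteristic zero, `g₂, g₃ ∈ k` with `g₂³ - 27g₃² ≠ 0`, `(Xᵢ, Yᵢ)` affine `K`-points of
`Y² = 4X³ - g₂X - g₃` with `Yᵢ ≠ 0`, `cᵢ ∈ k`, `v ∈ K`, and suppose `Σ cᵢ δXᵢ/Yᵢ = δv` for every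
`k`-derivation `δ` of `K`. Then `v` is algebraic over `k`. See the module docstring for the proof
(transcendence basis through `s = v⁻¹`, `θ = t·d/dt` on `k₁(t) ≅ k₁(s)`, extension to `K`,
Galois averaging of points down to `k₁(t)`, Laurent expansion at `t = 0`).
[cite: Kirby2009, Prop. 3.7 and Thm. 3.8 (proof, case S = Eⁿ)] -/
theorem isAlgebraic_of_sum_invDiff {k K : Type*} [Field k] [CharZero k] [Field K] [Algebra k K]
    {ι : Type*} [Fintype ι] {g₂ g₃ : k} (hΔ : g₂ ^ 3 - 27 * g₃ ^ 2 ≠ 0) (c : ι → k)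
    (X Y : ι → K)
    (hE : ∀ i, Y i ^ 2 = 4 * X i ^ 3 - algebraMap k K g₂ * X i - algebraMap k K g₃)
    (hY : ∀ i, Y i ≠ 0) (v : K)
    (H : ∀ δ : Derivation k K K, ∑ i, algebraMap k K (c i) * ((Y i)⁻¹ * δ (X i)) = δ v) :
    IsAlgebraic k v := by
  classical
  by_contra hv
  haveI : CharZero K := charZero_of_injective_algebraMap (algebraMap k K).injective
  have hv0 : v ≠ 0 := by rintro rfl; exact hv isAlgebraic_zero
  -- `s = v⁻¹` is transcendental; a transcendence basis through it
  have hs : Transcendental k v⁻¹ := fun h => hv (by simpa using h.inv)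
  obtain ⟨k₁, htr, halg, -⟩ := exists_derivation_of_transcendental hs
  set s : K := v⁻¹ with hs_def
  haveI : CharZero k₁ := charZero_of_injective_algebraMap (algebraMap k k₁).injective
  -- `L = k₁(s) ≅ k₁(X)`
  set L : IntermediateField k₁ K := k₁⟮s⟯ with hL_def
  haveI : CharZero L := charZero_of_injective_algebraMap (algebraMap k₁ L).injective
  haveI hLK : Algebra.IsAlgebraic L K := halg
  set sL : L := IntermediateField.AdjoinSimple.gen k₁ s with hsL_def
  have hsL : (sL : K) = s := IntermediateField.AdjoinSimple.coe_gen k₁ s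
  have hs0 : s ≠ 0 := inv_ne_zero hv0
  let e : RatFunc k₁ ≃ₐ[k₁] L := RatFunc.algEquivOfTranscendental s htr
  have heX : e RatFunc.X = sL := by
    apply Subtype.ext
    rw [hsL]
    exact RatFunc.algEquivOfTranscendental_X s htr
  -- the Euler derivation on `k₁(X)`, transported to `L`
  obtain ⟨θ₀, hθ₀X⟩ := Rosenlicht.exists_eulerDerivation_ratFunc k₁
  obtain ⟨θL, hθL⟩ := exists_derivation_algEquiv_conj e θ₀
  have hθL' : ∀ y : L, e.symm (θL y) = θ₀ (e.symm y) := fun y => by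
    conv_lhs => rw [← e.apply_symm_apply y, hθL]
    rw [e.symm_apply_apply]
  have hθLs : θL sL = sL := by rw [← heX, hθL, hθ₀X]
  -- `L` as a differential field
  letI dL : Differential L := ⟨θL.restrictScalars ℤ⟩
  have hderivL : ∀ y : L, y′ = θL y := fun _ => rfl
  -- `K' = L(X, Y)`, a finite extension of `L`, with its differential structure
  set S : Set K := Set.range X ∪ Set.range Y with hS_def
  set K' : IntermediateField L K := IntermediateField.adjoin L S with hK'_def
  haveI : FiniteDimensional L K' := IntermediateField.finiteDimensional_adjoin fun x _ =>
    (Algebra.IsAlgebraic.isAlgebraic (R := L) x).isIntegral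
  have hXK' : ∀ i, X i ∈ K' := fun i =>
    IntermediateField.subset_adjoin L S (Set.mem_union_left _ ⟨i, rfl⟩)
  have hYK' : ∀ i, Y i ∈ K' := fun i =>
    IntermediateField.subset_adjoin L S (Set.mem_union_right _ ⟨i, rfl⟩)
  set X' : ι → K' := fun i => ⟨X i, hXK' i⟩ with hX'_def
  set Y' : ι → K' := fun i => ⟨Y i, hYK' i⟩ with hY'_def
  have hY'0 : ∀ i, Y' i ≠ 0 := fun i h => hY i (congrArg Subtype.val h)
  have hX'v : ∀ i, (X' i : K) = X i := fun _ => rfl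
  have hY'v : ∀ i, (Y' i : K) = Y i := fun _ => rfl
  -- the derivation of `K'`, extended to `K`, is a `k`-derivation
  obtain ⟨θZ, hθZ⟩ := Derivation.exists_extension_of_charZero (R := ℤ) (F := K') (T := K) (M := K)
    ((Algebra.linearMap K' K).compDer Differential.deriv)
  have hθZ' : ∀ t : K', θZ (t : K) = ((t′ : K') : K) := fun t => hθZ t
  have hcoe : ∀ y : L, ((algebraMap L K' y : K') : K) = (y : K) := fun _ => rfl
  have hθZL : ∀ y : L, θZ (y : K) = ((θL y : L) : K) := fun y => by
    rw [← hcoe, hθZ', deriv_algebraMap, hderivL, hcoe]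
  have hθZk : ∀ a : k, θZ (algebraMap k K a) = 0 := fun a => by
    have h1 : algebraMap k K a = ((algebraMap k₁ L (algebraMap k k₁ a) : L) : K) := rfl
    rw [h1, hθZL, Derivation.map_algebraMap]
    rfl
  let θk : Derivation k K K :=
    { toFun := θZ
      map_add' := map_add θZ
      map_smul' := fun a x => derivation_map_smul_of_forall_algebraMap θZ hθZk a x
      map_one_eq_zero' := θZ.map_one_eq_zero
      leibniz' := fun x y => θZ.leibniz x y }
  -- the relation for `θ`, in `K`: `Σ cᵢ θXᵢ/Yᵢ = θ v = -v`
  have hθZs : θZ s = s := by rw [← hsL, hθZL, hθLs]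
  have hθZv : θZ v = -v := by
    rw [show v = s⁻¹ by rw [hs_def, inv_inv], θZ.leibniz_inv, hθZs, smul_eq_mul]
    field_simp
  have hK : ∑ i, algebraMap k K (c i) * ((Y i)⁻¹ * θZ (X i)) = -v := by
    rw [← hθZv]; exact H θk
  -- the coefficients in `k₁` and in `L`
  set c₁ : ι → k₁ := fun i => algebraMap k k₁ (c i) with hc₁_def
  set cL : ι → L := fun i => algebraMap k₁ L (c₁ i) with hcL_def
  have hcLK : ∀ i, ((cL i : L) : K) = algebraMap k K (c i) := fun _ => rfl
  set A₁ : k₁ := algebraMap k k₁ (-g₂ / 4) with hA₁_def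
  set B₁ : k₁ := algebraMap k k₁ (-g₃ / 4) with hB₁_def
  set A : L := algebraMap k₁ L A₁ with hA_def
  set B : L := algebraMap k₁ L B₁ with hB_def
  have hAK : ((A : L) : K) = algebraMap k K (-g₂ / 4) := rfl
  have hBK : ((B : L) : K) = algebraMap k K (-g₃ / 4) := rfl
  have hAB : 4 * A₁ ^ 3 + 27 * B₁ ^ 2 ≠ 0 := by
    rw [hA₁_def, hB₁_def, ← map_pow, ← map_pow, ← map_ofNat (algebraMap k k₁) 4,
      ← map_ofNat (algebraMap k k₁) 27, ← map_mul, ← map_mul, ← map_add, _root_.map_ne_zero,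
      four_mul_cube_add]
    field_simp
    simpa using hΔ
  -- the curve over `L` and the points over `K'`
  set W : Affine L := WeierstrassCurve.mk 0 0 0 A B with hW_def
  have hW : IsShortConst W Differential.deriv :=
    { a₁ := rfl, a₂ := rfl, a₃ := rfl
      a₄ := by change θL (algebraMap k₁ L A₁) = 0; exact θL.map_algebraMap A₁
      a₆ := by change θL (algebraMap k₁ L B₁) = 0; exact θL.map_algebraMap B₁ }
  have hcoeK' : ∀ y : L, ((algebraMap L K' y : K') : K) = (y : K) := fun _ => rfl
  have hns : ∀ i, (W⁄K').Nonsingular (X' i) (Y' i / 2) := by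
    intro i
    rw [nonsingular_iff']
    refine ⟨?_, Or.inr ?_⟩
    · rw [equation_iff]
      change (Y' i / 2) ^ 2 + algebraMap L K' 0 * X' i * (Y' i / 2) + algebraMap L K' 0 * (Y' i / 2) =
          X' i ^ 3 + algebraMap L K' 0 * X' i ^ 2 + algebraMap L K' A * X' i + algebraMap L K' B
      simp only [map_zero, zero_mul, add_zero]
      apply Subtype.val_injective
      have h2K : ((2 : K') : K) = 2 := map_ofNat (algebraMap K' K) 2
      push_cast
      rw [hX'v, hY'v, h2K, hcoeK', hcoeK', hAK, hBK, map_div₀, map_div₀, map_neg, map_neg,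
        map_ofNat]
      linear_combination (1 / 4 : K) * hE i
    · change (2 * (Y' i / 2) + algebraMap L K' 0 * X' i + algebraMap L K' 0 : K') ≠ 0
      rw [map_zero, zero_mul, add_zero, add_zero, mul_div_cancel₀ _ (two_ne_zero' K')]
      exact hY'0 i
  set P : ι → (W⁄K').Point := fun i => Point.some (X' i) (Y' i / 2) (hns i) with hP_def
  have hPl : ∀ i, ((invDiff (W⁄K') Differential.deriv (P i) : K') : K) = (Y i)⁻¹ * θZ (X i) := by
    intro i
    rw [hP_def, invDiff_some]
    change (((X' i)′ / (2 * (Y' i / 2) + algebraMap L K' 0 * X' i + algebraMap L K' 0) : K') : K) = _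
    rw [map_zero, zero_mul, add_zero, add_zero, mul_div_cancel₀ _ (two_ne_zero' K'),
      IntermediateField.coe_div, ← hθZ', inv_mul_eq_div]
  -- the relation in `K'`
  have key : algebraMap L K' (-sL⁻¹) =
      ∑ i, algebraMap L K' (cL i) * invDiff (W⁄K') Differential.deriv (P i) := by
    apply Subtype.val_injective
    simp only [IntermediateField.coe_sum, IntermediateField.coe_mul, hPl, hcoeK', hcLK]
    push_cast
    rw [hK, hsL, hs_def, inv_inv]
  -- Galois averaging: descend to `L`
  obtain ⟨N, hN, μ, hμ, hNa⟩ := exists_nat_mul_eq_sum_invDiff hW (-sL⁻¹) cL P key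
  -- transport to `k₁(X)` and compare the coefficients of `X⁻¹`
  have hμ' : ∀ i, (((e.symm (μ i) : RatFunc k₁)) : k₁⸨X⸩).coeff (-1) = 0 := by
    intro i
    rcases hμ i with h0 | ⟨U, V, hUV, hV, hμi⟩
    · rw [h0, map_zero, map_zero, HahnSeries.coeff_zero]
    · have hV' : e.symm V ≠ 0 := (_root_.map_ne_zero e.symm).mpr hV
      have hUV' : e.symm V ^ 2 = e.symm U ^ 3 + RatFunc.C A₁ * e.symm U + RatFunc.C B₁ := by
        have := congrArg e.symm hUV
        rw [map_pow, map_add, map_add, map_mul, map_pow] at this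
        rw [this]
        change _ + e.symm (algebraMap k₁ L A₁) * _ + e.symm (algebraMap k₁ L B₁) = _
        rw [AlgEquiv.commutes, AlgEquiv.commutes, RatFunc.algebraMap_eq_C]
      rw [hμi, map_div₀, hderivL, hθL', map_mul, map_ofNat]
      exact coeff_neg_one_invDiff_ratFunc θ₀ hθ₀X hAB hV' hUV'
  have hRat : -((N : RatFunc k₁) * RatFunc.X⁻¹) = ∑ i, RatFunc.C (c₁ i) * e.symm (μ i) := by
    have h3 := congrArg e.symm hNa
    rw [map_mul, map_natCast, map_neg, map_inv₀, ← heX, e.symm_apply_apply, map_sum] at h3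
    rw [show -((N : RatFunc k₁) * RatFunc.X⁻¹) = (N : RatFunc k₁) * -RatFunc.X⁻¹ by ring, h3]
    refine Finset.sum_congr rfl fun i _ => ?_
    rw [map_mul, AlgEquiv.commutes, RatFunc.algebraMap_eq_C]
  have hL : (((-((N : RatFunc k₁) * RatFunc.X⁻¹) : RatFunc k₁)) : k₁⸨X⸩).coeff (-1) = -N := by
    rw [map_neg, HahnSeries.coeff_neg, coeff_neg_one_natCast_mul_inv_X]
  have hR : (((∑ i, RatFunc.C (c₁ i) * e.symm (μ i) : RatFunc k₁)) : k₁⸨X⸩).coeff (-1) = 0 := by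
    rw [map_sum, HahnSeries.coeff_sum]
    exact Finset.sum_eq_zero fun i _ => by
      rw [map_mul, LaurentEuler.coe_ratFunc_C, HahnSeries.C_mul_eq_smul, HahnSeries.coeff_smul,
        hμ' i, smul_zero]
  have hc : (((-((N : RatFunc k₁) * RatFunc.X⁻¹) : RatFunc k₁)) : k₁⸨X⸩).coeff (-1) =
      (((∑ i, RatFunc.C (c₁ i) * e.symm (μ i) : RatFunc k₁)) : k₁⸨X⸩).coeff (-1) := by rw [hRat]
  rw [hL, hR, neg_eq_zero, Nat.cast_eq_zero] at hc
  exact hN hc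

end AxSchanuelWeierstrass

end Literature.NumberTheory.Transcendental
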